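import Literature.NumberTheory.LFunctions.RudnickSarnakRefine
import Literature.NumberTheory.LFunctions.RudnickSarnakSieving
import HarnessLib

/-!
# Partial matchings of the blocks of `Q` and admissible coarsenings of `Q`

Rudnick–Sarnak, Duke Math. J. **81** (1996), proof of Proposition 4.1 (p. 308): a *marking*
of a set partition `Q` — a choice of `r ≥ 0` disjoint pairs of blocks of `Q` — is the same as a
set partition `F ≥ Q` each of whose blocks is a union of at most two blocks of `Q`
("`(Q, b) → F`"). With the blocks of `Q` labelled by `ι : Fin n → Fin (m+1)` (`ι a = ι b` iff
`a, b` share a block, `ι` onto), a marking is a partial matching `M` of the labels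
(`IsPartialMatching`, the index set of RS (3.9)), and:

* `mergeBy ι M` — the coarsening `F` of `Q` merging the matched pairs of blocks (the kernel
  partition of `a ↦ rootM M (ι a)`, `rootM` sending the larger label of a pair to the smaller);
* `matchOf Q ι F` — the matching of labels induced by an admissible coarsening `F`;
* `matchOf_mergeBy`, `mergeBy_matchOf`, `isPartialMatching_matchOf`, `mem_adm_mergeBy` — these
  are inverse bijections between partial matchings of `Fin (m+1)` and `{F : Q ∈ Adm F}`
  (`sum_matchings_eq_sum_coarsenings`).

## References

* Z. Rudnick, P. Sarnak, Duke Math. J. 81 (1996), (3.9), proof of Prop. 4.1.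
-/

noncomputable section

open Finset

namespace Literature.NumberTheory.LFunctions

namespace RudnickSarnak

variable {n m : ℕ} (Q : Finpartition (univ : Finset (Fin n))) (ι : Fin n → Fin (m + 1))

/-! ## Partial matchings: elementary facts -/

/-- Two pairs of a partial matching sharing a label are equal. [folklore] -/
theorem IsPartialMatching.eq_of_mem_mem {M : Finset (Fin (m + 1) × Fin (m + 1))}
    (hM : IsPartialMatching M) {p q : Fin (m + 1) × Fin (m + 1)} (hp : p ∈ M) (hq : q ∈ M)
    {x : Fin (m + 1)} (hxp : x ∈ ({p.1, p.2} : Finset (Fin (m + 1))))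
    (hxq : x ∈ ({q.1, q.2} : Finset (Fin (m + 1)))) : p = q := by
  by_contra hne
  exact Finset.disjoint_left.1 (hM.2 hp hq hne) hxp hxq

/-- The relation "equal or matched". [folklore] -/
def MRel (M : Finset (Fin (m + 1) × Fin (m + 1))) (b b' : Fin (m + 1)) : Prop :=
  b = b' ∨ (b, b') ∈ M ∨ (b', b) ∈ M

/-- The root of a label: the smaller label of its pair if it is the larger one, else itself.
[cite: RudnickSarnak1996, proof of Prop 4.1] -/
def rootM (M : Finset (Fin (m + 1) × Fin (m + 1))) (b : Fin (m + 1)) : Fin (m + 1) :=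
  (insert b ((M.filter fun p ↦ p.2 = b).image Prod.fst)).min' (Finset.insert_nonempty _ _)

/-- The root of the larger label of a pair is the smaller label. [folklore] -/
theorem rootM_eq_fst {M : Finset (Fin (m + 1) × Fin (m + 1))} (hM : IsPartialMatching M)
    {p : Fin (m + 1) × Fin (m + 1)} (hp : p ∈ M) : rootM M p.2 = p.1 := by
  unfold rootM
  refine le_antisymm ?_ ?_
  · refine Finset.min'_le _ _ (Finset.mem_insert_of_mem ?_)
    exact Finset.mem_image.2 ⟨p, Finset.mem_filter.2 ⟨hp, rfl⟩, rfl⟩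
  · have hmem := Finset.min'_mem (insert p.2 ((M.filter fun q ↦ q.2 = p.2).image Prod.fst))
      (Finset.insert_nonempty _ _)
    rcases Finset.mem_insert.1 hmem with h | h
    · rw [h]
      exact (hM.1 p hp).le
    · obtain ⟨q, hq, hq1⟩ := Finset.mem_image.1 h
      obtain ⟨hqM, hq2⟩ := Finset.mem_filter.1 hq
      have : q = p := IsPartialMatching.eq_of_mem_mem hM hqM hp (x := q.2) (by simp) (by simp [hq2])
      rw [← hq1, this]

/-- A label which is not the larger label of a pair is its own root. [folklore] -/
theorem rootM_eq_self {M : Finset (Fin (m + 1) × Fin (m + 1))} {b : Fin (m + 1)}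
    (hb : ∀ p ∈ M, p.2 ≠ b) : rootM M b = b := by
  unfold rootM
  have : (M.filter fun p ↦ p.2 = b) = ∅ := by
    rw [Finset.filter_eq_empty_iff]
    exact fun p hp ↦ hb p hp
  simp [this]

/-- The smaller label of a pair is its own root. [folklore] -/
theorem rootM_eq_self_of_fst {M : Finset (Fin (m + 1) × Fin (m + 1))} (hM : IsPartialMatching M)
    {p : Fin (m + 1) × Fin (m + 1)} (hp : p ∈ M) : rootM M p.1 = p.1 := by
  refine rootM_eq_self fun q hq h ↦ ?_
  have : q = p := IsPartialMatching.eq_of_mem_mem hM hq hp (x := q.2) (by simp) (by simp [h])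
  subst this
  exact (hM.1 q hq).ne' h

/-- **Roots agree iff the labels are equal or matched.** [folklore] -/
theorem rootM_eq_rootM_iff {M : Finset (Fin (m + 1) × Fin (m + 1))} (hM : IsPartialMatching M)
    (b b' : Fin (m + 1)) : rootM M b = rootM M b' ↔ MRel M b b' := by
  -- classify a label: larger label of a (unique) pair, or not
  have hcl : ∀ c : Fin (m + 1), (∃ p ∈ M, p.2 = c ∧ rootM M c = p.1) ∨
      ((∀ p ∈ M, p.2 ≠ c) ∧ rootM M c = c) := by
    intro c
    by_cases h : ∃ p ∈ M, p.2 = c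
    · obtain ⟨p, hp, rfl⟩ := h
      exact Or.inl ⟨p, hp, rfl, rootM_eq_fst hM hp⟩
    · push Not at h
      exact Or.inr ⟨h, rootM_eq_self h⟩
  constructor
  · intro h
    rcases hcl b with ⟨p, hp, rfl, hrp⟩ | ⟨hb, hrb⟩ <;>
      rcases hcl b' with ⟨q, hq, rfl, hrq⟩ | ⟨hb', hrb'⟩
    · -- both larger labels: same smaller label forces the same pair
      rw [hrp, hrq] at h
      have : p = q := IsPartialMatching.eq_of_mem_mem hM hp hq (x := p.1) (by simp) (by simp [h])
      subst this
      exact Or.inl rfl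
    · rw [hrp, hrb'] at h
      exact Or.inr (Or.inr (by rw [← h]; exact hp))
    · rw [hrb, hrq] at h
      exact Or.inr (Or.inl (by rw [h]; exact hq))
    · rw [hrb, hrb'] at h
      exact Or.inl h
  · rintro (rfl | h | h)
    · rfl
    · rw [show b' = (b, b').2 from rfl, rootM_eq_fst hM h, show b = (b, b').1 from rfl,
        rootM_eq_self_of_fst hM h]
    · rw [show b = (b', b).2 from rfl, rootM_eq_fst hM h, show b' = (b', b).1 from rfl,
        rootM_eq_self_of_fst hM h]

/-- Two distinct pairs of a matching cannot both relate a label to two others. [folklore] -/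
theorem IsPartialMatching.eq_or_eq_of_mRel {M : Finset (Fin (m + 1) × Fin (m + 1))}
    (hM : IsPartialMatching M) {x y z : Fin (m + 1)} (hxy : MRel M x y) (hyz : MRel M y z) :
    x = y ∨ y = z ∨ x = z := by
  rcases hxy with rfl | hxy | hxy
  · exact Or.inl rfl
  · rcases hyz with rfl | hyz | hyz
    · exact Or.inr (Or.inl rfl)
    · have := IsPartialMatching.eq_of_mem_mem hM hxy hyz (x := y) (by simp) (by simp)
      exact Or.inl (by rw [Prod.mk.injEq] at this; exact this.1)
    · have := IsPartialMatching.eq_of_mem_mem hM hxy hyz (x := y) (by simp) (by simp)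
      exact Or.inr (Or.inr (by rw [Prod.mk.injEq] at this; exact this.1))
  · rcases hyz with rfl | hyz | hyz
    · exact Or.inr (Or.inl rfl)
    · have := IsPartialMatching.eq_of_mem_mem hM hxy hyz (x := y) (by simp) (by simp)
      exact Or.inr (Or.inr (by rw [Prod.mk.injEq] at this; exact this.2))
    · have := IsPartialMatching.eq_of_mem_mem hM hxy hyz (x := y) (by simp) (by simp)
      exact Or.inl (by rw [Prod.mk.injEq] at this; exact this.2)

/-! ## Merging matched blocks -/

/-- The coarsening of `Q` merging the pairs of blocks matched by `M`.
[cite: RudnickSarnak1996, proof of Prop 4.1] -/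
def mergeBy (M : Finset (Fin (m + 1) × Fin (m + 1))) : Finpartition (univ : Finset (Fin n)) :=
  kerPart fun a ↦ rootM M (ι a)

/-- The matching of labels induced by a coarsening `F` of `Q`: pairs of labels of distinct
`Q`-blocks inside one `F`-block. [cite: RudnickSarnak1996, proof of Prop 4.1] -/
def matchOf (F : Finpartition (univ : Finset (Fin n))) : Finset (Fin (m + 1) × Fin (m + 1)) :=
  univ.filter fun p ↦ p.1 < p.2 ∧
    ∃ a b : Fin n, ι a = p.1 ∧ ι b = p.2 ∧ F.part a = F.part b ∧ Q.part a ≠ Q.part b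

/-- [folklore] -/
theorem mem_matchOf {F : Finpartition (univ : Finset (Fin n))} {p : Fin (m + 1) × Fin (m + 1)} :
    p ∈ matchOf Q ι F ↔ p.1 < p.2 ∧
      ∃ a b : Fin n, ι a = p.1 ∧ ι b = p.2 ∧ F.part a = F.part b ∧ Q.part a ≠ Q.part b := by
  simp [matchOf]

section labels

variable (hι : ∀ a b : Fin n, ι a = ι b ↔ Q.part a = Q.part b) (hιs : Function.Surjective ι)
include hι

omit hι in
/-- The block relation of `mergeBy M`. [folklore] -/
theorem mem_part_mergeBy {M : Finset (Fin (m + 1) × Fin (m + 1))} (hM : IsPartialMatching M)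
    {a b : Fin n} : b ∈ (mergeBy ι M).part a ↔ MRel M (ι a) (ι b) := by
  unfold mergeBy
  rw [mem_part_kerPart, rootM_eq_rootM_iff hM]

/-- `Q` refines `mergeBy M`. [folklore] -/
theorem part_subset_part_mergeBy {M : Finset (Fin (m + 1) × Fin (m + 1))} (hM : IsPartialMatching M)
    (a : Fin n) : Q.part a ⊆ (mergeBy ι M).part a := by
  intro b hb
  rw [mem_part_mergeBy ι hM]
  exact Or.inl ((hι a b).2 (Q.part_eq_of_mem (Q.part_mem.2 (mem_univ a)) hb).symm)

/-- **`Q` is an admissible refinement of `mergeBy M`.** [cite: RudnickSarnak1996, proof of Prop 4.1] -/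
theorem mem_adm_mergeBy {M : Finset (Fin (m + 1) × Fin (m + 1))} (hM : IsPartialMatching M) :
    Q ∈ Adm (mergeBy ι M) := by
  rw [mem_adm]
  refine ⟨part_subset_part_mergeBy Q ι hι hM, fun a b c hab hbc ↦ ?_⟩
  have hab' : MRel M (ι a) (ι b) := by
    rw [← mem_part_mergeBy ι hM, hab]
    exact (mergeBy ι M).mem_part_self.2 (mem_univ b)
  have hbc' : MRel M (ι b) (ι c) := by
    rw [← mem_part_mergeBy ι hM, hbc]
    exact (mergeBy ι M).mem_part_self.2 (mem_univ c)
  rcases IsPartialMatching.eq_or_eq_of_mRel hM hab' hbc' with h | h | h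
  · exact Or.inl ((hι a b).1 h)
  · exact Or.inr (Or.inl ((hι b c).1 h))
  · exact Or.inr (Or.inr ((hι a c).1 h))

include hιs

/-- **Round trip `M ↦ mergeBy M ↦ matchOf`.** [cite: RudnickSarnak1996, proof of Prop 4.1] -/
theorem matchOf_mergeBy {M : Finset (Fin (m + 1) × Fin (m + 1))} (hM : IsPartialMatching M) :
    matchOf Q ι (mergeBy ι M) = M := by
  ext p
  rw [mem_matchOf]
  constructor
  · rintro ⟨hlt, a, b, ha, hb, hG, hQ⟩
    have hrel : MRel M (ι a) (ι b) := by
      rw [← mem_part_mergeBy ι hM, hG]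
      exact (mergeBy ι M).mem_part_self.2 (mem_univ b)
    rw [ha, hb] at hrel
    rcases hrel with h | h | h
    · exact absurd ((hι a b).1 (by rw [ha, hb, h])) hQ
    · exact h
    · exact absurd (hM.1 _ h) (not_lt.2 hlt.le)
  · intro hp
    refine ⟨hM.1 p hp, ?_⟩
    obtain ⟨a, ha⟩ := hιs p.1
    obtain ⟨b, hb⟩ := hιs p.2
    refine ⟨a, b, ha, hb, ?_, ?_⟩
    · refine ((mergeBy ι M).part_eq_of_mem ((mergeBy ι M).part_mem.2 (mem_univ a)) ?_).symm
      rw [mem_part_mergeBy ι hM, ha, hb]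
      exact Or.inr (Or.inl hp)
    · intro h
      have : ι a = ι b := (hι a b).2 h
      rw [ha, hb] at this
      exact (hM.1 p hp).ne this

omit hιs in
/-- **The induced matching of an admissible coarsening is a partial matching.**
[cite: RudnickSarnak1996, proof of Prop 4.1] -/
theorem isPartialMatching_matchOf {F : Finpartition (univ : Finset (Fin n))} (hF : Q ∈ Adm F) :
    IsPartialMatching (matchOf Q ι F) := by
  obtain ⟨hsub, htwo⟩ := (mem_adm F).1 hF
  refine ⟨fun p hp ↦ ((mem_matchOf Q ι).1 hp).1, ?_⟩
  -- a label of a pair comes with witnesses `a` (that label) and `b` (the other label)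
  have hwit : ∀ p ∈ matchOf Q ι F, ∀ x ∈ ({p.1, p.2} : Finset (Fin (m + 1))),
      ∃ a b : Fin n, ι a = x ∧ ({ι a, ι b} : Finset (Fin (m + 1))) = {p.1, p.2} ∧
        F.part a = F.part b ∧ Q.part a ≠ Q.part b := by
    intro p hp x hx
    obtain ⟨-, a, b, ha, hb, hF', hQ'⟩ := (mem_matchOf Q ι).1 hp
    rcases Finset.mem_insert.1 hx with rfl | hx
    · exact ⟨a, b, ha, by rw [ha, hb], hF', hQ'⟩
    · rw [Finset.mem_singleton] at hx
      subst hx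
      exact ⟨b, a, hb, by rw [ha, hb, Finset.pair_comm], hF'.symm, fun h ↦ hQ' h.symm⟩
  intro p hp q hq hne
  rw [Function.onFun, Finset.disjoint_left]
  intro x hxp hxq
  apply hne
  obtain ⟨a, b, ha, hab, hFab, hQab⟩ := hwit p hp x hxp
  obtain ⟨c, d, hc, hcd, hFcd, hQcd⟩ := hwit q hq x hxq
  -- `a` and `c` share a `Q`-block, hence an `F`-block; apply the two-block condition to `b, a, d`
  have hQac : Q.part a = Q.part c := (hι a c).1 (ha.trans hc.symm)
  have hFac : F.part a = F.part c := by
    have : c ∈ F.part a := hsub a (hQac ▸ Q.mem_part_self.2 (mem_univ c))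
    exact (F.part_eq_of_mem (F.part_mem.2 (mem_univ a)) this).symm
  rcases htwo b a d hFab.symm (hFac.trans hFcd) with h | h | h
  · exact absurd h.symm hQab
  · exact absurd (hQac.symm.trans h) hQcd
  · -- `ι b = ι d`: the two pairs have the same labels
    have hbd : ι b = ι d := (hι b d).2 h
    have hsets : ({p.1, p.2} : Finset (Fin (m + 1))) = {q.1, q.2} := by
      rw [← hab, ← hcd, ha, hc, hbd]
    have hp1 : p.1 < p.2 := ((mem_matchOf Q ι).1 hp).1
    have hq1 : q.1 < q.2 := ((mem_matchOf Q ι).1 hq).1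
    -- sorted pairs with the same underlying set coincide
    have hmin : ∀ r : Fin (m + 1) × Fin (m + 1), r.1 < r.2 →
        ({r.1, r.2} : Finset (Fin (m + 1))).min' (Finset.insert_nonempty _ _) = r.1 := by
      intro r hr
      refine le_antisymm (Finset.min'_le _ _ (by simp)) (Finset.le_min' _ _ _ fun y hy ↦ ?_)
      rcases Finset.mem_insert.1 hy with rfl | hy
      · exact le_rfl
      · rw [Finset.mem_singleton] at hy
        rw [hy]
        exact hr.le
    have hmax : ∀ r : Fin (m + 1) × Fin (m + 1), r.1 < r.2 →
        ({r.1, r.2} : Finset (Fin (m + 1))).max' (Finset.insert_nonempty _ _) = r.2 := by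
      intro r hr
      refine le_antisymm (Finset.max'_le _ _ _ fun y hy ↦ ?_) (Finset.le_max' _ _ (by simp))
      rcases Finset.mem_insert.1 hy with rfl | hy
      · exact hr.le
      · rw [Finset.mem_singleton] at hy
        rw [hy]
    have h1 : p.1 = q.1 := by
      rw [← hmin p hp1, ← hmin q hq1]
      congr 1
    have h2 : p.2 = q.2 := by
      rw [← hmax p hp1, ← hmax q hq1]
      congr 1
    exact Prod.ext h1 h2

omit hιs in
/-- **Round trip `F ↦ matchOf F ↦ mergeBy`.** [cite: RudnickSarnak1996, proof of Prop 4.1] -/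
theorem mergeBy_matchOf {F : Finpartition (univ : Finset (Fin n))} (hF : Q ∈ Adm F) :
    mergeBy ι (matchOf Q ι F) = F := by
  obtain ⟨hsub, htwo⟩ := (mem_adm F).1 hF
  have hM := isPartialMatching_matchOf Q ι hι hF
  refine Finpartition.eq_of_forall_mem_part_iff fun a b ↦ ?_
  rw [mem_part_mergeBy ι hM]
  have hFQ : ∀ x y : Fin n, Q.part x = Q.part y → F.part x = F.part y := by
    intro x y h
    have : y ∈ F.part x := hsub x (h ▸ Q.mem_part_self.2 (mem_univ y))
    exact (F.part_eq_of_mem (F.part_mem.2 (mem_univ x)) this).symm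
  constructor
  · intro h
    have key : ∀ x y : Fin n, (ι x, ι y) ∈ matchOf Q ι F → F.part x = F.part y := by
      intro x y hxy
      obtain ⟨-, c, d, hc, hd, hFcd, -⟩ := (mem_matchOf Q ι).1 hxy
      exact (hFQ x c ((hι x c).1 hc.symm)).trans (hFcd.trans (hFQ d y ((hι d y).1 hd)))
    have hab : F.part a = F.part b := by
      rcases h with h | h | h
      · exact hFQ a b ((hι a b).1 h)
      · exact key a b h
      · exact (key b a h).symm
    rw [hab]
    exact F.mem_part_self.2 (mem_univ b)
  · intro hb
    have hFab : F.part a = F.part b := (F.part_eq_of_mem (F.part_mem.2 (mem_univ a)) hb).symm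
    by_cases hQ : Q.part a = Q.part b
    · exact Or.inl ((hι a b).2 hQ)
    · have hne : ι a ≠ ι b := fun h ↦ hQ ((hι a b).1 h)
      rcases lt_or_gt_of_ne hne with hlt | hlt
      · exact Or.inr (Or.inl ((mem_matchOf Q ι).2 ⟨hlt, a, b, rfl, rfl, hFab, hQ⟩))
      · exact Or.inr (Or.inr ((mem_matchOf Q ι).2 ⟨hlt, b, a, rfl, rfl, hFab.symm, fun h ↦ hQ h.symm⟩))

open scoped Classical in
/-- **Partial matchings of the labels ≃ admissible coarsenings of `Q`**, as a reindexing of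
sums: `∑_{M matching} f (mergeBy M) M = ∑_{F : Q ∈ Adm F} f F (matchOf F)`.
[cite: RudnickSarnak1996, proof of Prop 4.1] -/
theorem sum_matchings_eq_sum_coarsenings {R : Type*} [AddCommMonoid R]
    (f : Finpartition (univ : Finset (Fin n)) → Finset (Fin (m + 1) × Fin (m + 1)) → R) :
    ∑ M ∈ (univ : Finset (Finset (Fin (m + 1) × Fin (m + 1)))).filter IsPartialMatching,
        f (mergeBy ι M) M =
      ∑ F ∈ (univ : Finset (Finpartition (univ : Finset (Fin n)))).filter (fun F ↦ Q ∈ Adm F),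
        f F (matchOf Q ι F) := by
  refine Finset.sum_nbij' (mergeBy ι) (matchOf Q ι) ?_ ?_ ?_ ?_ ?_
  · intro M hM
    exact Finset.mem_filter.2 ⟨mem_univ _, mem_adm_mergeBy Q ι hι (Finset.mem_filter.1 hM).2⟩
  · intro F hF
    exact Finset.mem_filter.2 ⟨mem_univ _, isPartialMatching_matchOf Q ι hι (Finset.mem_filter.1 hF).2⟩
  · intro M hM
    exact matchOf_mergeBy Q ι hι hιs (Finset.mem_filter.1 hM).2
  · intro F hF
    exact mergeBy_matchOf Q ι hι (Finset.mem_filter.1 hF).2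
  · intro M hM
    rw [matchOf_mergeBy Q ι hι hιs (Finset.mem_filter.1 hM).2]

end labels

end RudnickSarnak

end Literature.NumberTheory.LFunctions

end
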